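import Summits.AnomalousDissipation.AnomalousDissipation.Theses.TwoAndHalfD
import Literature.Analysis.FluidPDE.TwoHalfNavierStokes
import Literature.Analysis.FluidPDE.LongTimeAverageNonneg
import Literature.Barriers.AnomalousDissipation.TwoDimensionalEnergyDissipationL2Data

/-!
# Stub `stub_planarNoAnomaly` (S2) of the line `log-kantorovich-enstrophy-transfer` for the crux
# `TwoAndHalfD.TwohalfdNeg` (stmt-AnomalousDissipation-0211): the planar half

No energy-dissipation anomaly for bounded-energy, steadily forced two-dimensional Leray–Hopf
families from ARBITRARY `L²` data, for every smooth divergence-free mean-zero steady force `g`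
on `T²` (including `g = 0`) and without any positivity assumption on `U_j`: along `ν_j → 0`,
`⟨ν_j‖∇v_j‖₂²⟩ → 0`. This is the catalogued barrier Alexakis–Doering 2006 §2 USED, in the
unrestricted form `Literature.Barriers.AnomalousDissipation.tendsto_meanDissipation_zero_of_L2`
(`TwoDimensionalEnergyDissipationL2Data`): `ε_j² ≤ ν_j ‖Δg‖_∞ U_j³ ≤ ν_j ‖Δg‖_∞ E^{3/2} → 0`,
where the vendored restrictions (force `F Φ(n • x)`, smooth datum, `U > 0`) are removed by
(a) working with `‖Δg‖_∞` directly, (b) restarting each `v_j` at an a.e. time `s > 0` with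
`v_j(s) ∈ H¹` from which the energy inequality holds — the translate is again a global
Leray–Hopf solution (`Torus.IsGlobalLerayHopf.exists_isGlobalLerayHopf_translate`,
`LerayHopfRestartTorus`) and the `limsup` means `ε`, `U` are translation invariant
(`LongTimeAverageShift`) — and (c) replacing `U > 0` by the bounded running means of the energy
supplied by the Doering–Foias a-priori estimate (`∫ g = 0`). The hypothesis `Torus.IsDivFree g`
of the registered signature is not needed by the proof (the weak formulation only sees the
solenoidal part of the force) and is simply discarded. Supports stmt-AnomalousDissipation-0211.
-/

namespace Summit.AnomalousDissipation.AnomalousDissipation.Theorems.TwohalfdNeg.PlanarNoAnomaly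

open MeasureTheory Filter Topology
open scoped ENNReal NNReal
open Literature.Analysis.FunctionSpaces Literature.Analysis.FluidPDE

set_option linter.dupNamespace false

/-- **S2 `stub_planarNoAnomaly` — no energy-dissipation anomaly for bounded-energy steadily
forced 2-D Leray–Hopf families, ALL `L²` data.** For every smooth divergence-free mean-zero
steady `g` on `T²` (including `g = 0`), `ν_j > 0` with `ν_j → 0` and global Leray–Hopf `v_j`
forced by `g` with `sup_j ⟨‖v_j‖₂²⟩ < ∞`: `⟨ν_j‖∇v_j‖₂²⟩ → 0` (Alexakis–Doering 2006, §2: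
`ε² ≤ ν U² χ`, `χ ≤ ‖Δg‖_∞ U`, at `L²` data via restart at an a.e. positive time and
translation invariance of the `limsup` means; `U = 0` allowed). Direct instance of
`Literature.Barriers.AnomalousDissipation.tendsto_meanDissipation_zero_of_L2`. -/
theorem stub_planarNoAnomaly :
    ∀ g : UnitAddTorus (Fin 2) → EuclideanSpace ℝ (Fin 2),
      Torus.IsSmooth g → Torus.IsDivFree g → Torus.HasZeroMean g →
      ∀ (ν : ℕ → ℝ) (v₀ : ℕ → UnitAddTorus (Fin 2) → EuclideanSpace ℝ (Fin 2))
        (v : ℕ → ℝ → UnitAddTorus (Fin 2) → EuclideanSpace ℝ (Fin 2)),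
        (∀ j, 0 < ν j) → Tendsto ν atTop (𝓝 0) →
        (∀ j, Torus.IsGlobalLerayHopf (ν j) (fun _ => g) (v₀ j) (v j)) →
        (∃ E : ℝ, ∀ j, meanEnergy (v j) ≤ E) →
        Tendsto (fun j => meanDissipation (ν j) (v j)) atTop (𝓝 0) := by
  intro g hgs _hgd hgz ν v₀ v hν hν0 hLH hE
  exact Literature.Barriers.AnomalousDissipation.tendsto_meanDissipation_zero_of_L2 g hgs hgz ν v₀ v
    hν hν0 hLH hE

end Summit.AnomalousDissipation.AnomalousDissipation.Theorems.TwohalfdNeg.PlanarNoAnomaly
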